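import Literature.NumberTheory.Sieve.QuadraticRootsPrimeModuliDFI
import Literature.NumberTheory.Sieve.SieveFramework
import Literature.NumberTheory.LFunctions.MertensFormula
import Literature.NumberTheory.LFunctions.MertensElementary
import HarnessLib

/-!
# Duke–Friedlander–Iwaniec 1995, §6: the elementary estimates feeding Lemmas 2–3 and Theorem 5

Topic `Literature/NumberTheory/Sieve`.  Analytic inputs, all PROVED from Mathlib and the tree, for
the discharge of `Literature.NumberTheory.Sieve.dukeFriedlanderIwaniec1995_theorem5` (§6 of
W. Duke, J. B. Friedlander, H. Iwaniec, Ann. of Math. 141 (1995), pp. 433–437):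

* the crude bound (27) for sequences `|c_n| ≤ τ(n)` on `n ≤ x`: `γ(d) = τ(d) d^{−1}`, `X = x(1 + log x)`
  (`DFI1995.norm_sum_quotSeq_le`, from `τ(dm) ≤ τ(d)τ(m)` and `∑_{m ≤ N} τ(m) ≤ N(1 + log N)`,
  `DFI1995.sum_card_divisors_le`);
* harmonic windows `∑_{u ≤ n < v} 1/n ≤ 1/u + log(v/u)` (`DFI1995.sum_inv_le_of_forall_mem_Ico`; the
  paper's `∑_{y_{k+1} ≤ p < y_k} γ(p) ≤ c(w^{−1} + log(y_k/y_{k+1}))`, p. 436);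
* `∑_{p ≤ x} 1/p ≤ log log x + 4` (tree, `MertensBound.sum_inv_prime_le`) and the Mertens window
  `∑_{u < p ≤ v} 1/p ≤ log(log v/log u) + 16/log u` (tree, `Mertens.abs_primeRecipSum_sub_le`);
* Chebyshev: `π(t) ≤ (2 log 4 + 2) t/log t` for `t ≥ 2` and `x/log x ≪ π(x)` eventually (Mathlib,
  `Chebyshev.pi_le_log4_mul_div`; tree, `isBigO_div_log_primeCounting`);
* Rankin's trick for the tail of Legendre's expansion (p. 435 with `ε = log 2/log w`):
  `∑_{d ∣ P(w), d ≥ E} τ(d)/d ≤ 2^{−log E/log w} exp(4(log log w + 4))` (`DFI1995.sum_tail_divisors_le`).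

## References

* W. Duke, J. B. Friedlander, H. Iwaniec, Ann. of Math. (2) 141 (1995), 423–441, §6 pp. 435–437.
  [cite: DukeFriedlanderIwaniec1995, §6 pp. 435–437]
-/

namespace Literature.NumberTheory.Sieve

open scoped BigOperators
open Finset Real Filter

namespace DFI1995

noncomputable section

/-! ### The divisor function: `τ(dm) ≤ τ(d)τ(m)` and `∑_{m ≤ N} τ(m) ≤ N(1 + log N)` -/

/-- `τ(mn) ≤ τ(m) τ(n)` (every divisor of `mn` is a product of a divisor of `m` and one of `n`).
[folklore] -/
theorem card_divisors_mul_le (m n : ℕ) : (m * n).divisors.card ≤ m.divisors.card * n.divisors.card := by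
  rw [Nat.divisors_mul]
  exact Finset.card_mul_le

/-- **Dirichlet's bound, crude form**: `∑_{1 ≤ m ≤ N} τ(m) = ∑_{d ≤ N} ⌊N/d⌋ ≤ N (1 + log N)`.
[folklore] -/
theorem sum_card_divisors_le (N : ℕ) :
    ∑ m ∈ Icc 1 N, (m.divisors.card : ℝ) ≤ N * (1 + Real.log N) := by
  have hI : ∀ n : ℕ, Icc 1 n = Ioc 0 n := fun n => by
    ext m; simp only [Finset.mem_Ioc, Finset.mem_Icc]; omega
  -- `τ(m) = ∑_{d ≤ N, d ∣ m} 1` for `1 ≤ m ≤ N`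
  have h1 : ∑ m ∈ Icc 1 N, (m.divisors.card : ℝ) =
      ∑ m ∈ Icc 1 N, ∑ d ∈ Icc 1 N, (if d ∣ m then (1 : ℝ) else 0) := by
    refine Finset.sum_congr rfl fun m hm => ?_
    rw [Finset.mem_Icc] at hm
    rw [← Finset.sum_filter, Finset.sum_const, nsmul_eq_mul, mul_one]
    congr 1
    congr 1
    ext d
    simp only [Nat.mem_divisors, Finset.mem_filter, Finset.mem_Icc]
    constructor
    · rintro ⟨hd, hm0⟩
      exact ⟨⟨Nat.pos_of_dvd_of_pos hd (by omega), (Nat.le_of_dvd (by omega) hd).trans hm.2⟩, hd⟩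
    · rintro ⟨⟨-, -⟩, hd⟩
      exact ⟨hd, by omega⟩
  rw [h1, Finset.sum_comm]
  -- inner sums: `#{m ≤ N : d ∣ m} = N / d ≤ N/d`
  have h2 : ∀ d ∈ Icc 1 N, ∑ m ∈ Icc 1 N, (if d ∣ m then (1 : ℝ) else 0) ≤ (N : ℝ) * (d : ℝ)⁻¹ := by
    intro d hd
    rw [Finset.mem_Icc] at hd
    rw [← Finset.sum_filter, Finset.sum_const, nsmul_eq_mul, mul_one, hI, Nat.Ioc_filter_dvd_card_eq_div]
    rw [← div_eq_mul_inv]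
    exact Nat.cast_div_le
  refine (Finset.sum_le_sum h2).trans ?_
  rw [← Finset.mul_sum]
  have h3 : ∑ d ∈ Icc 1 N, (d : ℝ)⁻¹ = ((harmonic N : ℚ) : ℝ) := by
    rw [harmonic_eq_sum_Icc]; push_cast; rfl
  rw [h3]
  exact mul_le_mul_of_nonneg_left (harmonic_le_one_add_log N) (Nat.cast_nonneg N)

/-- **The crude bound (27) with `γ(d) = τ(d)/d`, `X = x(1 + log x)`** (p. 437: "then (27) holds with
`γ(d) = τ(d)d^{−1}` and `X ≪ x log x`"): if `|c_n| ≤ τ(n)` for `n ≥ 1`, then for `d ≥ 1`, `x ≥ 1` and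
every set `s` of integers `1 ≤ m ≤ ⌊x⌋/d`, `|∑_{m ∈ s} c_{dm}| ≤ τ(d) (x/d) (1 + log x)`.
[cite: DukeFriedlanderIwaniec1995, §6 (27) and p. 437] -/
theorem norm_sum_quotSeq_le {c : ℕ → ℂ} (hc : ∀ n : ℕ, 1 ≤ n → ‖c n‖ ≤ (Nat.divisors n).card)
    {d : ℕ} (hd : 1 ≤ d) {x : ℝ} (hx : 1 ≤ x) {s : Finset ℕ} (hs : s ⊆ Icc 1 (⌊x⌋₊ / d)) :
    ‖∑ m ∈ s, c (d * m)‖ ≤ (d.divisors.card : ℝ) * (x / d) * (1 + Real.log x) := by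
  set N := ⌊x⌋₊ / d with hN
  have hx0 : 0 < x := by linarith
  have hlogx : 0 ≤ Real.log x := Real.log_nonneg hx
  have hNx : (N : ℝ) ≤ x / d := by
    rw [hN, le_div_iff₀ (by exact_mod_cast hd)]
    calc ((⌊x⌋₊ / d : ℕ) : ℝ) * d = ((⌊x⌋₊ / d * d : ℕ) : ℝ) := by push_cast; ring
      _ ≤ ⌊x⌋₊ := by exact_mod_cast Nat.div_mul_le_self _ _
      _ ≤ x := Nat.floor_le hx0.le
  calc ‖∑ m ∈ s, c (d * m)‖ ≤ ∑ m ∈ s, ‖c (d * m)‖ := norm_sum_le _ _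
    _ ≤ ∑ m ∈ s, (d.divisors.card : ℝ) * (m.divisors.card : ℝ) := by
        refine Finset.sum_le_sum fun m hm => ?_
        have hm1 : 1 ≤ m := (Finset.mem_Icc.1 (hs hm)).1
        refine (hc (d * m) (Nat.mul_pos hd hm1)).trans ?_
        exact_mod_cast card_divisors_mul_le d m
    _ ≤ ∑ m ∈ Icc 1 N, (d.divisors.card : ℝ) * (m.divisors.card : ℝ) :=
        Finset.sum_le_sum_of_subset_of_nonneg hs fun _ _ _ => by positivity
    _ = (d.divisors.card : ℝ) * ∑ m ∈ Icc 1 N, (m.divisors.card : ℝ) := by rw [Finset.mul_sum]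
    _ ≤ (d.divisors.card : ℝ) * (N * (1 + Real.log N)) :=
        mul_le_mul_of_nonneg_left (sum_card_divisors_le N) (Nat.cast_nonneg _)
    _ ≤ (d.divisors.card : ℝ) * ((x / d) * (1 + Real.log x)) := by
        refine mul_le_mul_of_nonneg_left ?_ (Nat.cast_nonneg _)
        rcases Nat.eq_zero_or_pos N with hN0 | hNpos
        · rw [hN0]; simp only [Nat.cast_zero, zero_mul]; positivity
        · have hN1 : (1 : ℝ) ≤ N := by exact_mod_cast hNpos
          have hlogN : Real.log N ≤ Real.log x :=
            Real.log_le_log (by linarith) (hNx.trans (div_le_self hx0.le (by exact_mod_cast hd)))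
          have : 0 ≤ 1 + Real.log N := by
            have := Real.log_nonneg hN1; linarith
          gcongr
    _ = (d.divisors.card : ℝ) * (x / d) * (1 + Real.log x) := by ring

/-! ### Harmonic windows -/

/-- `∑_{a ≤ n ≤ b} 1/n ≤ 1/a + log b − log a` for `1 ≤ a ≤ b` (`1/n ≤ log n − log(n−1)`). [folklore] -/
theorem sum_Icc_inv_le {a b : ℕ} (ha : 1 ≤ a) (hab : a ≤ b) :
    ∑ n ∈ Icc a b, (n : ℝ)⁻¹ ≤ (a : ℝ)⁻¹ + Real.log b - Real.log a := by
  induction b, hab using Nat.le_induction with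
  | base => simp
  | succ b hab ih =>
    rw [Finset.sum_Icc_succ_top (by omega)]
    have hb0 : (0 : ℝ) < b := by exact_mod_cast (show 0 < b by omega)
    have hb1 : (0 : ℝ) < (b : ℝ) + 1 := by linarith
    -- `1/(b+1) ≤ log (b+1) - log b`
    have hstep : ((b + 1 : ℕ) : ℝ)⁻¹ ≤ Real.log ((b + 1 : ℕ) : ℝ) - Real.log b := by
      push_cast
      have h := Real.one_sub_inv_le_log_of_pos (show 0 < ((b : ℝ) + 1) / b by positivity)
      rw [Real.log_div hb1.ne' hb0.ne', inv_div] at h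
      have e : 1 - (b : ℝ) / (b + 1) = ((b : ℝ) + 1)⁻¹ := by field_simp; ring
      linarith
    linarith

/-- **Harmonic window**: if every element of `S ⊆ ℕ` lies in `[u, v)` with `1 ≤ u`, then
`∑_{n ∈ S} 1/n ≤ 1/u + log(v/u)` (p. 436, the bound `∑_{y_{k+1} ≤ m < y_k} m^{−1} ≤ w^{−1} + log(y_k/y_{k+1})`).
[cite: DukeFriedlanderIwaniec1995, §6 p. 436] -/
theorem sum_inv_le_of_forall_mem_Ico {u v : ℝ} (hu : 1 ≤ u) (huv : u ≤ v) {S : Finset ℕ}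
    (hS : ∀ n ∈ S, u ≤ (n : ℝ) ∧ (n : ℝ) < v) :
    ∑ n ∈ S, (n : ℝ)⁻¹ ≤ u⁻¹ + Real.log (v / u) := by
  have hu0 : 0 < u := by linarith
  have hv0 : 0 < v := by linarith
  rcases S.eq_empty_or_nonempty with rfl | ⟨n₀, hn₀⟩
  · simp only [Finset.sum_empty]
    have : 0 ≤ Real.log (v / u) := Real.log_nonneg ((one_le_div hu0).2 huv)
    positivity
  set a := ⌈u⌉₊ with ha
  set b := ⌈v⌉₊ - 1 with hb
  have ha1 : 1 ≤ a := Nat.one_le_iff_ne_zero.2 (Nat.ceil_pos.2 hu0).ne'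
  have hmem : ∀ n ∈ S, n ∈ Icc a b := by
    intro n hn
    obtain ⟨h1, h2⟩ := hS n hn
    rw [Finset.mem_Icc]
    refine ⟨Nat.ceil_le.2 h1, ?_⟩
    have : n < ⌈v⌉₊ := Nat.lt_ceil.2 h2
    omega
  have hab : a ≤ b := by
    have := Finset.mem_Icc.1 (hmem n₀ hn₀); omega
  have hua : u ≤ a := Nat.le_ceil u
  have hbv : (b : ℝ) ≤ v := by
    have h1 : b < ⌈v⌉₊ := by
      have : 0 < ⌈v⌉₊ := Nat.ceil_pos.2 hv0
      omega
    exact (le_of_lt (Nat.lt_ceil.1 h1))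
  calc ∑ n ∈ S, (n : ℝ)⁻¹ ≤ ∑ n ∈ Icc a b, (n : ℝ)⁻¹ :=
        Finset.sum_le_sum_of_subset_of_nonneg (fun n hn => hmem n hn) fun _ _ _ => by positivity
    _ ≤ (a : ℝ)⁻¹ + Real.log b - Real.log a := sum_Icc_inv_le ha1 hab
    _ ≤ u⁻¹ + Real.log v - Real.log u := by
        have h1 : (a : ℝ)⁻¹ ≤ u⁻¹ := inv_anti₀ hu0 hua
        have h2 : Real.log a ≥ Real.log u := Real.log_le_log hu0 hua
        have h3 : Real.log b ≤ Real.log v := by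
          rcases Nat.eq_zero_or_pos b with hb0 | hbpos
          · rw [hb0, Nat.cast_zero, Real.log_zero]; exact Real.log_nonneg (by linarith)
          · exact Real.log_le_log (by exact_mod_cast hbpos) hbv
        linarith
    _ = u⁻¹ + Real.log (v / u) := by rw [Real.log_div hv0.ne' hu0.ne']; ring

/-! ### Sums of `1/p`: Mertens-type bounds from the tree -/

/-- `∑_{p ∈ S} 1/p ≤ log log x + 4` for any set `S` of primes `≤ x`, `x ≥ 2`
(tree: `MertensBound.sum_inv_prime_le`). [folklore] -/
theorem sum_inv_primes_le_loglog {x : ℝ} (hx : 2 ≤ x) {S : Finset ℕ}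
    (hS : ∀ p ∈ S, p.Prime ∧ (p : ℝ) ≤ x) :
    ∑ p ∈ S, (p : ℝ)⁻¹ ≤ Real.log (Real.log x) + 4 := by
  have hx0 : 0 < x := by linarith
  have hN : 2 ≤ ⌊x⌋₊ := Nat.le_floor (by exact_mod_cast hx)
  have hsub : S ⊆ Nat.primesLE ⌊x⌋₊ := by
    intro p hp
    obtain ⟨hpp, hpx⟩ := hS p hp
    exact Nat.mem_primesLE.2 ⟨Nat.le_floor hpx, hpp⟩
  have h := Literature.NumberTheory.LFunctions.MertensBound.sum_inv_prime_le ⌊x⌋₊ hN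
  have hlog : Real.log (Real.log ⌊x⌋₊) ≤ Real.log (Real.log x) := by
    have h2 : (2 : ℝ) ≤ ⌊x⌋₊ := by exact_mod_cast hN
    have hl : 0 < Real.log ⌊x⌋₊ := Real.log_pos (by linarith)
    exact Real.log_le_log hl (Real.log_le_log (by linarith) (Nat.floor_le hx0.le))
  calc ∑ p ∈ S, (p : ℝ)⁻¹ ≤ ∑ p ∈ Nat.primesLE ⌊x⌋₊, (p : ℝ)⁻¹ :=
        Finset.sum_le_sum_of_subset_of_nonneg hsub fun _ _ _ => by positivity
    _ = ∑ p ∈ Nat.primesLE ⌊x⌋₊, (1 : ℝ) / p := by simp [one_div]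
    _ ≤ Real.log (Real.log x) + 4 := h.trans (by linarith)

/-- **Mertens window**: for `2 ≤ u ≤ v` and any set `S` of primes in `(u, v]`,
`∑_{p ∈ S} 1/p ≤ log(log v / log u) + 16/log u` (Mertens' second theorem with the rate `8/log`,
tree: `Mertens.abs_primeRecipSum_sub_le`). [folklore] -/
theorem sum_inv_primes_window_le {u v : ℝ} (hu : 2 ≤ u) (huv : u ≤ v) {S : Finset ℕ}
    (hS : ∀ p ∈ S, p.Prime ∧ u < (p : ℝ) ∧ (p : ℝ) ≤ v) :
    ∑ p ∈ S, (p : ℝ)⁻¹ ≤ Real.log (Real.log v / Real.log u) + 16 / Real.log u := by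
  open Literature.NumberTheory.LFunctions.Mertens in
  have hv : 2 ≤ v := hu.trans huv
  have hlu : 0 < Real.log u := Real.log_pos (by linarith)
  have hlv : 0 < Real.log v := Real.log_pos (by linarith)
  have hluv : Real.log u ≤ Real.log v := Real.log_le_log (by linarith) huv
  have hU := abs_primeRecipSum_sub_le hu
  have hV := abs_primeRecipSum_sub_le hv
  rw [abs_le] at hU hV
  -- `∑_{S} ≤ primeRecipSum v - primeRecipSum u`
  have hsub : S ⊆ Nat.primesLE ⌊v⌋₊ \ Nat.primesLE ⌊u⌋₊ := by
    intro p hp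
    obtain ⟨hpp, hup, hpv⟩ := hS p hp
    rw [Finset.mem_sdiff, Nat.mem_primesLE, Nat.mem_primesLE]
    refine ⟨⟨Nat.le_floor hpv, hpp⟩, fun h => ?_⟩
    have : (p : ℝ) ≤ u := (Nat.le_floor_iff (by linarith)).1 h.1
    linarith
  have hmono : Nat.primesLE ⌊u⌋₊ ⊆ Nat.primesLE ⌊v⌋₊ := by
    intro p hp
    rw [Nat.mem_primesLE] at hp ⊢
    exact ⟨hp.1.trans (Nat.floor_mono huv), hp.2⟩
  have hdiff : primeRecipSum v - primeRecipSum u =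
      ∑ p ∈ Nat.primesLE ⌊v⌋₊ \ Nat.primesLE ⌊u⌋₊, (p : ℝ)⁻¹ := by
    unfold primeRecipSum
    rw [Finset.sum_sdiff_eq_sub hmono]
  calc ∑ p ∈ S, (p : ℝ)⁻¹ ≤ ∑ p ∈ Nat.primesLE ⌊v⌋₊ \ Nat.primesLE ⌊u⌋₊, (p : ℝ)⁻¹ :=
        Finset.sum_le_sum_of_subset_of_nonneg hsub fun _ _ _ => by positivity
    _ = primeRecipSum v - primeRecipSum u := hdiff.symm
    _ ≤ (Real.log (Real.log v) + 8 / Real.log v) - (Real.log (Real.log u) - 8 / Real.log u) := by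
        linarith [hU.1, hV.2]
    _ ≤ Real.log (Real.log v / Real.log u) + 16 / Real.log u := by
        rw [Real.log_div hlv.ne' hlu.ne']
        have h8 : 8 / Real.log v ≤ 8 / Real.log u := div_le_div_of_nonneg_left (by norm_num) hlu hluv
        have h16 : 16 / Real.log u = 8 / Real.log u + 8 / Real.log u := by ring
        rw [h16]
        linarith

/-! ### Chebyshev's bounds for `π` -/

/-- **Chebyshev's upper bound, explicit**: `π(t) ≤ (2 log 4 + 2) t / log t` for `t ≥ 2`
(Mathlib: `Chebyshev.pi_le_log4_mul_div`, with `√t ≤ 2t/log t`). [folklore] -/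
theorem primeCounting_le_mul_div_log {t : ℝ} (ht : 2 ≤ t) :
    (Nat.primeCounting ⌊t⌋₊ : ℝ) ≤ (2 * Real.log 4 + 2) * t / Real.log t := by
  have ht0 : 0 < t := by linarith
  have hlt : 0 < Real.log t := Real.log_pos (by linarith)
  have h := Chebyshev.pi_le_log4_mul_div (show (1 : ℝ) < t by linarith)
  have hsqrt : Real.log (Real.sqrt t) = Real.log t / 2 := by
    rw [Real.log_sqrt ht0.le]
  rw [hsqrt] at h
  -- `√t ≤ 2 t / log t` since `log t ≤ 2 √t`
  have hs : Real.sqrt t ≤ 2 * t / Real.log t := by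
    rw [le_div_iff₀ hlt]
    have h1 : Real.log t ≤ t ^ (1 / 2 : ℝ) / (1 / 2) := Real.log_le_rpow_div ht0.le (by norm_num)
    rw [← Real.sqrt_eq_rpow] at h1
    have hst : Real.sqrt t * Real.sqrt t = t := Real.mul_self_sqrt ht0.le
    have hs0 : 0 ≤ Real.sqrt t := Real.sqrt_nonneg t
    nlinarith
  calc (Nat.primeCounting ⌊t⌋₊ : ℝ) ≤ Real.log 4 * t / (Real.log t / 2) + Real.sqrt t := h
    _ ≤ Real.log 4 * t / (Real.log t / 2) + 2 * t / Real.log t := by linarith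
    _ = (2 * Real.log 4 + 2) * t / Real.log t := by field_simp

/-- **Chebyshev's lower bound, asymptotic**: there is `C > 0` with `x / log x ≤ C π(x)` for all large
real `x` (tree: `isBigO_div_log_primeCounting`). [folklore] -/
theorem exists_eventually_div_log_le_primeCounting :
    ∃ C : ℝ, 0 < C ∧ ∀ᶠ x : ℝ in atTop, x / Real.log x ≤ C * (Nat.primeCounting ⌊x⌋₊ : ℝ) := by
  obtain ⟨C, hC0, hC⟩ := isBigO_div_log_primeCounting.exists_pos
  refine ⟨2 * C, by positivity, ?_⟩
  have hev := (tendsto_nat_floor_atTop (α := ℝ)).eventually hC.bound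
  filter_upwards [hev, eventually_ge_atTop (4 : ℝ)] with x hx hx4
  have hx0 : 0 < x := by linarith
  have hN : 4 ≤ ⌊x⌋₊ := Nat.le_floor (by exact_mod_cast hx4)
  have hN2 : (2 : ℝ) ≤ ⌊x⌋₊ := by exact_mod_cast (show 2 ≤ ⌊x⌋₊ by omega)
  have hlN : 0 < Real.log ⌊x⌋₊ := Real.log_pos (by linarith)
  have hlx : Real.log ⌊x⌋₊ ≤ Real.log x := Real.log_le_log (by linarith) (Nat.floor_le hx0.le)
  have hxN : x ≤ 2 * ⌊x⌋₊ := by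
    have := Nat.lt_floor_add_one x; linarith
  rw [Real.norm_of_nonneg (by positivity), Real.norm_of_nonneg (Nat.cast_nonneg _)] at hx
  calc x / Real.log x ≤ (2 * ⌊x⌋₊) / Real.log ⌊x⌋₊ := by
        gcongr
    _ = 2 * ((⌊x⌋₊ : ℝ) / Real.log ⌊x⌋₊) := by ring
    _ ≤ 2 * (C * (Nat.primeCounting ⌊x⌋₊ : ℝ)) := by gcongr
    _ = 2 * C * (Nat.primeCounting ⌊x⌋₊ : ℝ) := by ring

/-! ### Rankin's trick for the tail of Legendre's expansion -/

/-- **Rankin's trick** (p. 435, "on choosing `ε = log 2/log w`", specialised to `γ(d) = τ(d)/d`):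
for `w ≥ 2` and `E > 0`,
`∑_{d ∣ P(w), d ≥ E} τ(d)/d ≤ 2^{−log E/log w} · exp(4 (log log w + 4))`
(`τ(d)/d ≤ E^{−δ} τ(d) d^{δ−1}`, `∑_{d ∣ P(w)} τ(d) d^{δ−1} = ∏_{p<w} (1 + 2p^{δ−1}) ≤ ∏_{p<w}(1 + 4/p)`
as `p^δ ≤ w^δ = 2`, and `∑_{p<w} 1/p ≤ log log w + 4`).
[cite: DukeFriedlanderIwaniec1995, §6 p. 435] -/
theorem sum_tail_divisors_le {w E : ℝ} (hw : 2 ≤ w) (hE : 0 < E) :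
    ∑ d ∈ (primesProdBelow w).divisors.filter (fun d : ℕ => E ≤ (d : ℝ)), (d.divisors.card : ℝ) / d ≤
      Real.exp (-(Real.log 2 * Real.log E / Real.log w)) *
        Real.exp (4 * (Real.log (Real.log w) + 4)) := by
  have hw0 : 0 < w := by linarith
  have hlw : 0 < Real.log w := Real.log_pos (by linarith)
  set δ : ℝ := Real.log 2 / Real.log w with hδ
  have hδ0 : 0 < δ := div_pos (Real.log_pos one_lt_two) hlw
  set P := primesProdBelow w with hP
  have hPsq : Squarefree P := squarefree_primesProdBelow w
  have hP0 : P ≠ 0 := primesProdBelow_ne_zero w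
  -- the multiplicative function `d ↦ τ(d) d^{δ-1}`
  let tauRpow : ArithmeticFunction ℝ :=
    ⟨fun d => if d = 0 then 0 else (d.divisors.card : ℝ) * (d : ℝ) ^ (δ - 1), if_pos rfl⟩
  have tauRpow_apply : ∀ {d : ℕ}, d ≠ 0 → tauRpow d = (d.divisors.card : ℝ) * (d : ℝ) ^ (δ - 1) := by
    intro d hd
    simp [tauRpow, hd]
  have hmult : tauRpow.IsMultiplicative := by
    refine ⟨by simp [tauRpow], fun {m n} hmn => ?_⟩
    rcases Nat.eq_zero_or_pos m with rfl | hm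
    · simp [tauRpow]
    rcases Nat.eq_zero_or_pos n with rfl | hn
    · simp [tauRpow]
    rw [tauRpow_apply (Nat.mul_pos hm hn).ne', tauRpow_apply hm.ne', tauRpow_apply hn.ne',
      Nat.Coprime.card_divisors_mul hmn, Nat.cast_mul, Nat.cast_mul,
      Real.mul_rpow (Nat.cast_nonneg m) (Nat.cast_nonneg n)]
    ring
  -- Step 1: termwise Rankin
  have h1 : ∀ d ∈ P.divisors.filter (fun d : ℕ => E ≤ (d : ℝ)),
      (d.divisors.card : ℝ) / d ≤ E ^ (-δ) * tauRpow d := by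
    intro d hd
    rw [Finset.mem_filter, Nat.mem_divisors] at hd
    obtain ⟨⟨hdP, -⟩, hEd⟩ := hd
    have hd0 : d ≠ 0 := fun h => hP0 (Nat.eq_zero_of_zero_dvd (h ▸ hdP))
    have hd0' : (0 : ℝ) < d := by exact_mod_cast Nat.pos_of_ne_zero hd0
    rw [tauRpow_apply hd0]
    have hrk : (d : ℝ) ^ (-δ) ≤ E ^ (-δ) := Real.rpow_le_rpow_of_nonpos hE hEd (by linarith)
    have e : (d.divisors.card : ℝ) / d = (d : ℝ) ^ (-δ) * ((d.divisors.card : ℝ) * (d : ℝ) ^ (δ - 1)) := by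
      rw [mul_left_comm, ← Real.rpow_add hd0', show -δ + (δ - 1) = (-1 : ℝ) by ring, Real.rpow_neg_one,
        div_eq_mul_inv]
    rw [e]
    exact mul_le_mul_of_nonneg_right hrk (by positivity)
  -- Step 2: full sum = Euler product
  have h2 : ∑ d ∈ P.divisors, tauRpow d = ∏ p ∈ P.primeFactors, (1 + tauRpow p) :=
    (hmult.prodPrimeFactors_one_add_of_squarefree hPsq).symm
  -- Step 3: each Euler factor `≤ exp (4/p)`
  have h3 : ∀ p ∈ P.primeFactors, 1 + tauRpow p ≤ Real.exp (4 * (p : ℝ)⁻¹) := by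
    intro p hp
    have hp' : p ∈ Nat.primesBelow ⌈w⌉₊ := by rwa [hP, primeFactors_primesProdBelow] at hp
    rw [Nat.mem_primesBelow, Nat.lt_ceil] at hp'
    obtain ⟨hpw, hpp⟩ := hp'
    have hp0 : (0 : ℝ) < p := by exact_mod_cast hpp.pos
    rw [tauRpow_apply hpp.ne_zero, Nat.Prime.divisors hpp, Finset.card_pair hpp.ne_one.symm]
    have hpδ : (p : ℝ) ^ δ ≤ 2 := by
      calc (p : ℝ) ^ δ ≤ w ^ δ := Real.rpow_le_rpow hp0.le hpw.le hδ0.le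
        _ = 2 := by
          rw [Real.rpow_def_of_pos hw0, hδ, mul_div_cancel₀ _ hlw.ne', Real.exp_log two_pos]
    have e : (p : ℝ) ^ (δ - 1) = (p : ℝ) ^ δ * (p : ℝ)⁻¹ := by
      rw [Real.rpow_sub_one hp0.ne', div_eq_mul_inv]
    rw [e]
    refine le_trans ?_ (Real.add_one_le_exp _)
    push_cast
    have : (0 : ℝ) ≤ (p : ℝ)⁻¹ := by positivity
    nlinarith
  -- Step 4: assemble
  have hsum_primes : ∑ p ∈ P.primeFactors, (p : ℝ)⁻¹ ≤ Real.log (Real.log w) + 4 := by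
    refine sum_inv_primes_le_loglog hw fun p hp => ?_
    have hp' : p ∈ Nat.primesBelow ⌈w⌉₊ := by rwa [hP, primeFactors_primesProdBelow] at hp
    rw [Nat.mem_primesBelow, Nat.lt_ceil] at hp'
    exact ⟨hp'.2, hp'.1.le⟩
  calc ∑ d ∈ P.divisors.filter (fun d : ℕ => E ≤ (d : ℝ)), (d.divisors.card : ℝ) / d
      ≤ ∑ d ∈ P.divisors.filter (fun d : ℕ => E ≤ (d : ℝ)), E ^ (-δ) * tauRpow d :=
        Finset.sum_le_sum h1
    _ ≤ ∑ d ∈ P.divisors, E ^ (-δ) * tauRpow d := by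
        refine Finset.sum_le_sum_of_subset_of_nonneg (Finset.filter_subset _ _) fun d hd _ => ?_
        have hd0 : d ≠ 0 := Nat.ne_of_gt (Nat.pos_of_mem_divisors hd)
        rw [tauRpow_apply hd0]; positivity
    _ = E ^ (-δ) * ∏ p ∈ P.primeFactors, (1 + tauRpow p) := by rw [← Finset.mul_sum, h2]
    _ ≤ E ^ (-δ) * ∏ p ∈ P.primeFactors, Real.exp (4 * (p : ℝ)⁻¹) := by
        refine mul_le_mul_of_nonneg_left (Finset.prod_le_prod (fun p hp => ?_) h3) (by positivity)
        have hp0 : p ≠ 0 := (Nat.prime_of_mem_primeFactors hp).ne_zero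
        rw [tauRpow_apply hp0]; positivity
    _ = E ^ (-δ) * Real.exp (4 * ∑ p ∈ P.primeFactors, (p : ℝ)⁻¹) := by
        rw [← Real.exp_sum, Finset.mul_sum]
    _ ≤ E ^ (-δ) * Real.exp (4 * (Real.log (Real.log w) + 4)) := by
        gcongr
    _ = Real.exp (-(Real.log 2 * Real.log E / Real.log w)) *
          Real.exp (4 * (Real.log (Real.log w) + 4)) := by
        rw [Real.rpow_def_of_pos hE, hδ]
        congr 2
        ring

end

end DFI1995

end Literature.NumberTheory.Sieve
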